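import Literature.Analysis.ValidatedNumerics.TaylorModelIntegralCertFamily
import HarnessLib

/-!
# The naive square root in Taylor-model integral certificates (domain edge)

Trunk T-ANA (Analysis/ValidatedNumerics); namespace `Literature.Analysis.ValidatedNumerics.PolyMP`.
The verified square-root statement of the kernel lane (`SOp.sqrt`, `checkSqrt` of `TaylorModel.lean`: a Newton candidate
`Q ≥ s/S > 0` with `|g − Q²| ≤ B/S`) needs the operand AND the candidate bounded away from `0` on the panel, so no panel
touching a zero of the operand is ever accepted — the situation of Mahboubi–Melquiond–Sibut-Pinote (JAR 62 (2019)),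
Sect. 5 (`∫₀¹ √(1−t²) dt`: "the integrand is poorly approximated near 1 (due to the square root), the integration domain
has to be split into small pieces around 1") and Sect. 6.1, fifth problem (`… √(1−x²) dx`: "there are some points where
no RPAs can be computed").  What their tactic computes on such a piece is the NAIVE integral enclosure of Sect. 3.1
(Lemmas 1–2: `∫ᵤᵛ f ∈ (v − u) · F(hull(u, v))` for an interval extension `F`), combined with the polynomial one by
Sect. 3.4; the interval extension of `√` is total ("division and square root on intervals are as simple as
multiplication", Martin-Dorel–Melquiond, JAR 57 (2015), Sect. 2.3; "expressions involving square roots or absolute values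
have no meaningful derivatives at point 0", ibid. Sect. 3.3), and in the data type of their approximations
`T ::= Dummy | Const I | Var | Tm (I[X] × I)` (ibid. Sect. 4.3.3) such a piece carries a degenerate, polynomial-free
member.  This file adds exactly that statement to the kernel lane, for every statement family at once (as
`TaylorModelIntegralCertFamilyAbs.lean` did for `|·|`):

* `sqrtNaiveCheck S h G r s` with **`tmem_sqrtNaive`** — the DEGENERATE Taylor model of degree `0` with constant
  coefficient `[r, s]` encloses `√g` on `|ρ| ≤ h` as soon as `0 ≤ r`, (`r = 0` or `r² ≤ S · inf(S·g)`) and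
  `S · sup(S·g) ≤ s²` for the range bounds `tlowerI` / `tupperI` of a model `G` of `g` — i.e. `[r/S, s/S] ⊇ √(hull g)`,
  the interval square root; NO positivity condition on the operand (where `g < 0`, Mathlib's `Real.sqrt g = 0 ∈ [0, s/S]`
  and the check forces `r = 0`);
* `SqrtNaiveOp Op` — the statements of ANY family `Op` plus one more, `sqrtN i` (push `√vᵢ` with the naive model; one
  certificate candidate `([r], s)` consumed); `SqrtNaiveOp.model` / `.evalF` / **`.tmem_model`**; the family
  transformer **`OpModel.withSqrtNaive M`** / **`OpSem.withSqrtNaive F`**, so that the generic certificates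
  `M.withSqrtNaive.certCheck` / `.panelCheck` of `TaylorModelIntegralCertFamily.lean` and their soundness theorems apply
  verbatim on the pieces next to a zero of a square root's operand, over every family of the library (`SOp`, `TOp`,
  `AOp`; plain, sharp or wide modellers), while the other pieces keep the family's verified `sqrt`;
* `toFunP_withSqrtNaive_map` — a program without `sqrtN` statements denotes the same function in `M.withSqrtNaive` as
  in `M` (and `sqrtN i` denotes the same real function `√vᵢ` as the family's `sqrt i`, so the two programs of one
  integrand are identified with the same closed form and their certified segments glue by `FSegOK.append`).

Problem-independent plumbing; no facts, no axioms.

## References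

* A. Mahboubi, G. Melquiond, T. Sibut-Pinote, *Formally verified approximations of definite integrals*,
  J. Automated Reasoning 62 (2019) 281–300: Sect. 3.1 Lemmas 1–2 (naive integral enclosure by an interval extension),
  Sect. 3.4 (its combination with the polynomial enclosure, dichotomy), Sect. 5 (the quarter disk `∫₀¹ √(1−t²)`, depth
  15 around `1`), Sect. 6.1 fifth problem (`T₁₂(x) e^{−(x−3/4)²} √(1−x²)` on `[−1, 1]`, "no RPAs can be computed" at some
  points; depth 16–35). [cite: MahboubiMelquiondSibutpinote2018, Sect. 3.1]
* É. Martin-Dorel, G. Melquiond, *Proving tight bounds on univariate expressions with elementary functions in Coq*,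
  J. Automated Reasoning 57 (2016) 187–217: Sect. 2.3 (interval square root), Sect. 3.3 (square root at `0`: no
  derivative, interval evaluation only), Sect. 4.3.3 (the type `T` with degenerate members next to Taylor models).
  [cite: MartindorelMelquiond2015, Sect. 4.3.3]
* G. Melquiond, *Proving bounds on real-valued functions with computations*, IJCAR 2008, LNCS 5195, 2–17, Sect. 3.3
  (straight-line programs; the evaluator generic in the operations). [cite: Melquiond2008, Sect. 3.3]
* M. Joldeş, *Rigorous Polynomial Approximations and Applications*, PhD thesis, ENS Lyon (2011): Algorithm 2.2.10
  (Taylor models of an expression by structural recursion). [cite: Joldes2011, Algorithm 2.2.10]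
-/

open MeasureTheory intervalIntegral Set

namespace Literature.Analysis.ValidatedNumerics

namespace PolyMP

open Literature.Analysis.ValidatedNumerics.NumericsMP
open Literature.Analysis.ValidatedNumerics.ExpPoly (Poly BPoly)
open Literature.Analysis.ValidatedNumerics.ExpPoly

/-! ### The naive (degree-0) Taylor model of `√g` -/

/-- **The interval square root, as a kernel check**: the scaled interval `[r, s]` encloses `√g` on the panel when
`0 ≤ r`, `r = 0 ∨ r² ≤ S · tlowerI(G)` and `S · tupperI(G) ≤ s²` (`G` a model of `g`; `tlowerI / tupperI` its scaled
range bounds).  No condition on the sign of the operand.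
[cite: MartindorelMelquiond2015, Sect. 2.3] [cite: MahboubiMelquiondSibutpinote2018, Sect. 3.1] -/
def sqrtNaiveCheck (S : ℕ) (h : ℚ) (G : IPoly) (r : ℤ) (s : ℕ) : Bool :=
  decide (0 ≤ r) && (decide (r = 0) || decide (r * r ≤ (S : ℤ) * tlowerI S h G)) &&
    decide ((S : ℤ) * tupperI S h G ≤ (s : ℤ) * s)

/-- **Soundness of the naive square root** (the degenerate model of degree `0`): if `G` encloses `g` on `|ρ| ≤ h` and
`sqrtNaiveCheck S h G r s` accepts, the constant model `[r, s]` encloses `√g` there.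
[cite: MahboubiMelquiondSibutpinote2018, Sect. 3.1] [cite: MartindorelMelquiond2015, Sect. 4.3.3] -/
theorem tmem_sqrtNaive {S : ℕ} (hS : 0 < S) {h : ℚ} (h0 : 0 ≤ h) {g : ℝ → ℝ} {G : IPoly} (hg : TMem S h g G)
    {r : ℤ} {s : ℕ} (hc : sqrtNaiveCheck S h G r s = true) :
    TMem S h (fun ρ => Real.sqrt (g ρ)) (tconst ⟨r, s⟩) := by
  have hSr : (0 : ℝ) < S := by exact_mod_cast hS
  unfold sqrtNaiveCheck at hc
  simp only [Bool.and_eq_true, Bool.or_eq_true, decide_eq_true_eq] at hc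
  obtain ⟨⟨hr0, hr⟩, hs⟩ := hc
  refine fun ρ hρ => tmem_const ⟨?_, ?_⟩ ρ hρ
  · -- lower end: `r ≤ √g · S`
    rcases hr with hr | hr
    · subst hr
      simpa using mul_nonneg (Real.sqrt_nonneg (g ρ)) hSr.le
    · have hL := tlowerI_le h0 hg hρ
      have hrR : ((r : ℝ)) * r ≤ (S : ℝ) * (tlowerI S h G : ℤ) := by exact_mod_cast hr
      have hr0R : (0 : ℝ) ≤ r := by exact_mod_cast hr0
      have h1 : ((r : ℝ) / S) ^ 2 ≤ g ρ := by
        rw [div_pow, div_le_iff₀ (by positivity)]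
        nlinarith
      have hg0 : 0 ≤ g ρ := le_trans (by positivity) h1
      have h2 : (r : ℝ) / S ≤ Real.sqrt (g ρ) := (Real.le_sqrt (by positivity) hg0).2 h1
      have := mul_le_mul_of_nonneg_right h2 hSr.le
      rwa [div_mul_cancel₀ _ hSr.ne'] at this
  · -- upper end: `√g · S ≤ s`
    have hU := le_tupperI h0 hg hρ
    have hsR : (S : ℝ) * (tupperI S h G : ℤ) ≤ (s : ℝ) * s := by exact_mod_cast hs
    have h1 : g ρ ≤ ((s : ℝ) / S) ^ 2 := by
      rw [div_pow, le_div_iff₀ (by positivity)]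
      nlinarith
    have h2 : Real.sqrt (g ρ) ≤ (s : ℝ) / S := (Real.sqrt_le_left (by positivity)).2 h1
    have := mul_le_mul_of_nonneg_right h2 hSr.le
    rw [div_mul_cancel₀ _ hSr.ne'] at this
    exact_mod_cast this

/-! ### Statements with the naive square root over any family -/

/-- The statements of a family `Op` extended by one more statement type: `sqrtN i` pushes `√vᵢ` (stack-relative
operand, as every statement), to be modelled naively. [cite: MahboubiMelquiondSibutpinote2018, Sect. 3.1]
[cite: Melquiond2008, Sect. 3.3] -/
inductive SqrtNaiveOp (Op : Type) : Type
  /-- a statement of the underlying family -/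
  | base (op : Op) : SqrtNaiveOp Op
  /-- push `√vᵢ`, naive model -/
  | sqrtN (i : ℕ) : SqrtNaiveOp Op

namespace SqrtNaiveOp

/-- default statement (for `getReg`-style total lookups): `sqrtN 0`. [cite: Melquiond2008, Sect. 3.3] -/
instance (Op : Type) : Inhabited (SqrtNaiveOp Op) := ⟨sqrtN 0⟩

variable {M : OpModel}

/-- **The statement modeller**: the family's own for a `base` statement; for `sqrtN i` one candidate `(rs, s)` is
consumed — the lower end `r` is the head of `rs` (default `0`), the upper end is `s` — and the constant model `[r, s]`
is pushed, accepted iff `sqrtNaiveCheck` passes on the operand's register model; with no candidate left the statement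
is refused. [cite: Joldes2011, Algorithm 2.2.10] [cite: MahboubiMelquiondSibutpinote2018, Sect. 3.1] -/
def model (M : OpModel) (prm : M.Prm) (S : ℕ) (h : ℚ) (c : ℚ) (Ws : List IPoly) :
    SqrtNaiveOp M.Op → List (List ℤ × ℕ) → WExpr.MRes
  | base op, cs => M.model prm S h c Ws op cs
  | sqrtN _, [] => ⟨[], [], false⟩
  | sqrtN i, d :: cs' =>
      ⟨tconst ⟨getReg 0 d.1 0, d.2⟩, cs', sqrtNaiveCheck S h (getReg [] Ws i) (getReg 0 d.1 0) d.2⟩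

/-- The real function pushed by a statement given the stack `fs`: what the underlying statement semantics `ev`
pushes, or `t ↦ √(vᵢ(t))` (generic in the statement type `Op`, so that the unfolding lemmas below are keyed on the
bare constructors). [cite: Melquiond2008, Sect. 3.3] -/
noncomputable def evalF {Op : Type} (ev : List (ℝ → ℝ) → Op → ℝ → ℝ) (fs : List (ℝ → ℝ)) :
    SqrtNaiveOp Op → ℝ → ℝ
  | base op => ev fs op
  | sqrtN i => fun t => Real.sqrt (getReg (fun _ => (0 : ℝ)) fs i t)

/-- A `base` statement pushes what it pushes in the underlying family. [cite: Melquiond2008, Sect. 3.3] -/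
@[simp] theorem evalF_base {Op : Type} (ev : List (ℝ → ℝ) → Op → ℝ → ℝ) (fs : List (ℝ → ℝ)) (op : Op) :
    evalF ev fs (base op) = ev fs op := rfl

/-- A `sqrtN i` statement pushes `t ↦ √(vᵢ(t))` — the same real function as a verified `sqrt i`.
[cite: MartindorelMelquiond2015, Sect. 3.3] -/
@[simp] theorem evalF_sqrtN {Op : Type} (ev : List (ℝ → ℝ) → Op → ℝ → ℝ) (fs : List (ℝ → ℝ)) (i : ℕ) :
    evalF ev fs (sqrtN i) = fun t => Real.sqrt (getReg (fun _ => (0 : ℝ)) fs i t) := rfl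

/-- [folklore] -/
private theorem measurable_evalF (F : OpSem M) {fs : List (ℝ → ℝ)}
    (hfs : ∀ i, Measurable (getReg (fun _ => (0 : ℝ)) fs i)) :
    ∀ op : SqrtNaiveOp M.Op, Measurable (evalF F.evalF fs op)
  | base op => F.measurable_evalF hfs op
  | sqrtN i => Real.continuous_sqrt.measurable.comp (hfs i)

/-- **Soundness of `SqrtNaiveOp.model`** under the stack invariant. [cite: Joldes2011, Algorithm 2.2.10]
[cite: MahboubiMelquiondSibutpinote2018, Sect. 3.1] -/
theorem tmem_model (F : OpSem M) (prm : M.Prm) {S : ℕ} (hS : 0 < S) {h : ℚ} (h0 : 0 ≤ h) (c : ℚ)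
    {fs : List (ℝ → ℝ)} {Ws : List IPoly} (hst : StackMem S h c fs Ws) :
    ∀ (op : SqrtNaiveOp M.Op) (cs : List (List ℤ × ℕ)), (model M prm S h c Ws op cs).ok = true →
      TMem S h (fun u => evalF F.evalF fs op ((c : ℝ) + u)) (model M prm S h c Ws op cs).P
  | base op, cs, hok => F.tmem_model prm hS h0 c hst op cs hok
  | sqrtN _, [], hok => by simp [model] at hok
  | sqrtN i, d :: cs', hok => tmem_sqrtNaive hS h0 (hst i) (by simpa [model] using hok)

end SqrtNaiveOp

/-- **The family transformer, computable half**: statements `SqrtNaiveOp M.Op`, the parameters of `M`, modeller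
`SqrtNaiveOp.model`. [cite: Melquiond2008, Sect. 3.3] [cite: MahboubiMelquiondSibutpinote2018, Sect. 3.1] -/
abbrev OpModel.withSqrtNaive (M : OpModel) : OpModel :=
  ⟨SqrtNaiveOp M.Op, M.Prm, fun prm S h c Ws op cs => SqrtNaiveOp.model M prm S h c Ws op cs⟩

/-- **The family transformer, semantic half**: semantics `SqrtNaiveOp.evalF`, soundness `SqrtNaiveOp.tmem_model` —
so `M.withSqrtNaive.certCheck` / `M.withSqrtNaive.panelCheck` certify integrals over the pieces next to a zero of a
square root's operand through `F.withSqrtNaive.integral_bounds_of_certCheck` / `.fsegOK_of_panelCheck`.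
[cite: Melquiond2008, Sect. 3.3] [cite: MahboubiMelquiondSibutpinote2018, Sect. 3.4] -/
noncomputable def OpSem.withSqrtNaive {M : OpModel} (F : OpSem M) : OpSem M.withSqrtNaive where
  evalF := SqrtNaiveOp.evalF F.evalF
  measurable_evalF := fun hfs op => SqrtNaiveOp.measurable_evalF F hfs op
  tmem_model := fun prm _ hS _ h0 c _ _ hst op cs hok => SqrtNaiveOp.tmem_model F prm hS h0 c hst op cs hok

/-- [folklore] -/
private theorem runF_withSqrtNaive_map {M : OpModel} (F : OpSem M) :
    ∀ (p : GProg M) (fs : List (ℝ → ℝ)), F.withSqrtNaive.runF (p.map SqrtNaiveOp.base) fs = F.runF p fs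
  | [], _ => rfl
  | _ :: p, _ => runF_withSqrtNaive_map F p _

/-- A program WITHOUT `sqrtN` statements denotes, in the extended family, the function it denotes in the underlying
one (so the identification lemmas `toFunP_slp` / `toFunP_trig` / `toFunP_atan` … carry over).
[cite: MahboubiMelquiondSibutpinote2016, Sect. 4.1] -/
@[simp] theorem toFunP_withSqrtNaive_map {M : OpModel} (F : OpSem M) (p : GProg M) (ps : List ℝ) :
    F.withSqrtNaive.toFunP (p.map SqrtNaiveOp.base) ps = F.toFunP p ps := by
  unfold OpSem.toFunP; rw [runF_withSqrtNaive_map]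

/-- The statement semantics of the extended family is `SqrtNaiveOp.evalF F.evalF` (with `SqrtNaiveOp.evalF_base` /
`SqrtNaiveOp.evalF_sqrtN`: for unfolding a certified `toFunP` to the integrand it denotes).
[cite: Melquiond2008, Sect. 3.3] -/
@[simp] theorem withSqrtNaive_evalF {M : OpModel} (F : OpSem M) :
    F.withSqrtNaive.evalF = SqrtNaiveOp.evalF F.evalF := rfl

end PolyMP

end Literature.Analysis.ValidatedNumerics
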